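import Summits.BirchSwinnertonDyer.BirchSwinnertonDyer.Theorems.Rank1ResidualJetPairingCountingPermutation
import HarnessLib

/-!
# T1 JET (cell `bsd-jet`), road K, stub S1: the LOCAL index `[(Π G_i)⁻ + Π F_i : Π F_i]` of the signed
# counting, evaluated at a swapped pair of places and at a fixed place (pure algebra)

HONEST FRAMING (programme file `BSD-LIT2PART-PROGRAMME-v1.md` §HONESTY, verbatim): «no tranche here
proves BSD; ARM L moves the LITERAL column of an r ≤ 1 census into the kernel-proved-modulo-named-print
column; ARM P changes what «named print» is worth.» THEOREMS ONLY (seat `bsd-jet-pv-1`, session g4;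
`--supports stmt-BirchSwinnertonDyer-14418`, helper): no definition, no named fact, no `sorry`;
PURE ALGEBRA. Nothing is booked; 0 classes move.

## What

The right-hand side of the signed counting identities
(`relIndex_mul_relIndex_eq_of_iInf_ker_sup_minus_of_piTransport`,
`relIndex_selmerGroup_mul_relIndex_dualSelmerGroup_minus`) is the local index
`(Π_i F_i).relIndex ((Π_i G_i) ∩ X⁻)`, `X⁻ = ker(τ_X + 1)` for the involution `τ_X` induced by the place
involution `π` and transports `eX`. Jetchev 2008 uses it in exactly two configurations (proof of
Thm. 6.3, p. 823; Lemma 5.2 (iii)), computed here in the definition-free style of the permutation layer: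

* `relIndex_pi_inf_ker_add_id_eq_of_swap` — **swapped pair**: `F_i = G_i` except at `j₀ ≠ π j₀`
  (a split `q`, places `v ≠ v̄`): the index is `[G_{j₀} : F_{j₀}]` (the `−`-part of
  `G_v/F_v ⊕ G_v̄/F_v̄` under the swap is one copy: `x_v̄ = −σ_* x_v`);
* `relIndex_pi_inf_ker_add_id_eq_of_fixed` — **fixed place**: `F_i = G_i` except at `j₀ = π j₀` (an
  inert Kolyvagin prime `λ`): the index is `(F_{j₀}).relIndex (G_{j₀} ∩ ker(eX j₀ j₀ + 1))`.

Both: kernel/surjectivity of the coordinate projection at `j₀` on `(Π G_i) ∩ X⁻`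
(`AddSubgroup.relIndex_comap`, `AddSubgroup.inf_relIndex_right`).
References (locators only; no cited FACT is declared): [cite: Jetchev2008, Lemma 5.2 (iii) (p. 822),
proof of Thm. 6.3 (p. 823)] [cite: MilneADT2006, Ch. I §0 (0.19)]. Design: no definitions;
`Type*`-polymorphic. Axioms: `propext`, `Classical.choice`, `Quot.sound`.
-/

set_option autoImplicit false

noncomputable section

open scoped Classical
open Function

namespace Summit.BirchSwinnertonDyer.Rank1Residual.JET.GlobalDuality

section LocalIndex

variable {ι : Type*} {X : ι → Type*} [∀ i, AddCommGroup (X i)] (π : ι → ι)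
  (eX : ∀ i j, X i →+ X j) (τX : (∀ i, X i) →+ (∀ i, X i))
  (hτX : ∀ x j, τX x j = eX (π j) j (x (π j)))
  (F G : ∀ i, AddSubgroup (X i))
include hτX

/-- On `X⁻ = ker(τ_X + 1)` the coordinate at `π j` is determined by the one at `j`:
`x_j = - eX (π j) j x_{π j}`. -/
theorem apply_eq_neg_of_mem_ker_add_id {x : ∀ i, X i} (hx : x ∈ (τX + AddMonoidHom.id _).ker)
    (j : ι) : x j = -eX (π j) j (x (π j)) := by
  rw [mem_ker_add_id_iff] at hx
  have := congrFun hx j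
  rw [hτX] at this
  rw [this, Pi.neg_apply, neg_neg]

omit hτX in
/-- The projection to the coordinate `j₀` identifies the index: if `(F_{j₀}).comap ev_{j₀}` and
`Π F_i` have the same intersection with `K`, then `(Π F_i).relIndex K = (F_{j₀}).relIndex (ev_{j₀} K)`.
Elementary (`relIndex_comap`, `inf_relIndex_right`). -/
theorem relIndex_pi_eq_relIndex_map_eval (j₀ : ι) (Ksub : AddSubgroup (∀ i, X i))
    (hK : (F j₀).comap (Pi.evalAddMonoidHom X j₀) ⊓ Ksub = AddSubgroup.pi Set.univ F ⊓ Ksub) :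
    (AddSubgroup.pi Set.univ F).relIndex Ksub =
      (F j₀).relIndex (Ksub.map (Pi.evalAddMonoidHom X j₀)) := by
  rw [← AddSubgroup.relIndex_comap,
    ← AddSubgroup.inf_relIndex_right ((F j₀).comap (Pi.evalAddMonoidHom X j₀)) Ksub, hK,
    AddSubgroup.inf_relIndex_right]

omit hτX in
/-- Membership in a product subgroup from membership of every coordinate. -/
theorem mem_pi_of_forall {x : ∀ i, X i} (h : ∀ i, x i ∈ F i) : x ∈ AddSubgroup.pi Set.univ F :=
  (AddSubgroup.mem_pi _).mpr fun i _ => h i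

omit hτX in
/-- Transport along `i = j₀` for a dependent function (avoids casts): if `i = j₀` then
`eX i k (x i) = eX j₀ k (x j₀)`. -/
theorem apply_apply_congr (x : ∀ i, X i) (k : ι) {i j₀ : ι} (h : i = j₀) :
    eX i k (x i) = eX j₀ k (x j₀) := by
  subst h
  rfl

/-- **The local index at a SWAPPED PAIR of places** (`π j₀ ≠ j₀`; a split `q` with `v ≠ v̄ = σ v`):
if `F_i = G_i` away from `{j₀, π j₀}`, the transports make the round trip at `j₀` and carry `F`,
`G` across the pair, then `(Π F_i).relIndex ((Π G_i) ∩ X⁻) = (F_{j₀}).relIndex (G_{j₀})` — the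
`−`-part of `G_{j₀}/F_{j₀} ⊕ G_{πj₀}/F_{πj₀}` under the swap is ONE copy (`x_{πj₀} = −eX x_{j₀}`).
In Jetchev's proof of Thm. 6.3 this is `#(H¹_{Kum}/H¹_{Kum⁰})(K_v) = p^{min(m, ord_p c_q)}` on the
`−ε` side. [cite: Jetchev2008, proof of Thm. 6.3 (p. 823), Lemma 5.2 (iii)] -/
theorem relIndex_pi_inf_ker_add_id_eq_of_swap (hπ : Involutive π) (j₀ : ι) (hj : π j₀ ≠ j₀)
    (hoff : ∀ i, i ≠ j₀ → i ≠ π j₀ → F i = G i)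
    (hround : ∀ y : X j₀, eX (π j₀) j₀ (eX j₀ (π j₀) y) = y)
    (sF : ∀ y : X j₀, y ∈ F j₀ → eX j₀ (π j₀) y ∈ F (π j₀))
    (sG : ∀ y : X j₀, y ∈ G j₀ → eX j₀ (π j₀) y ∈ G (π j₀)) :
    (AddSubgroup.pi Set.univ F).relIndex
        (AddSubgroup.pi Set.univ G ⊓ (τX + AddMonoidHom.id _).ker) =
      (F j₀).relIndex (G j₀) := by
  have hππ : π (π j₀) = j₀ := hπ j₀
  have hj' : j₀ ≠ π j₀ := fun h => hj h.symm
  -- the image of the projection is `G j₀`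
  have himg : (AddSubgroup.pi Set.univ G ⊓ (τX + AddMonoidHom.id _).ker).map
      (Pi.evalAddMonoidHom X j₀) = G j₀ := by
    apply le_antisymm
    · rintro _ ⟨x, hx, rfl⟩
      exact (AddSubgroup.mem_pi _).mp (AddSubgroup.mem_inf.mp hx).1 j₀ (Set.mem_univ _)
    · intro g hg
      -- the antisymmetric tuple supported on `{j₀, π j₀}` (no casts: `Pi.single`)
      let x : ∀ i, X i := Pi.single j₀ g + Pi.single (π j₀) (-eX j₀ (π j₀) g)
      have hx0 : x j₀ = g := by
        simp only [x, Pi.add_apply, Pi.single_eq_same, Pi.single_eq_of_ne hj', add_zero]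
      have hx1 : x (π j₀) = -eX j₀ (π j₀) g := by
        simp only [x, Pi.add_apply, Pi.single_eq_same, Pi.single_eq_of_ne hj, zero_add]
      have hx2 : ∀ i, i ≠ j₀ → i ≠ π j₀ → x i = 0 := fun i h1 h2 => by
        simp only [x, Pi.add_apply, Pi.single_eq_of_ne h1, Pi.single_eq_of_ne h2, add_zero]
      refine ⟨x, AddSubgroup.mem_inf.mpr ⟨mem_pi_of_forall G fun i => ?_, ?_⟩, hx0⟩
      · by_cases h1 : i = j₀
        · subst h1; rw [hx0]; exact hg
        by_cases h2 : i = π j₀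
        · subst h2; rw [hx1]; exact neg_mem (sG g hg)
        · rw [hx2 i h1 h2]; exact zero_mem _
      · rw [mem_ker_add_id_iff]
        funext i
        rw [hτX, Pi.neg_apply]
        by_cases h1 : i = j₀
        · subst h1
          rw [hx0, hx1, map_neg, hround]
        by_cases h2 : i = π j₀
        · subst h2
          rw [hx1, neg_neg, apply_apply_congr eX x (π j₀) hππ, hx0]
        · have h3 : π i ≠ j₀ := fun h => h2 (by rw [← h, hπ i])
          have h4 : π i ≠ π j₀ := fun h => h1 (hπ.injective h)
          rw [hx2 i h1 h2, hx2 (π i) h3 h4, map_zero, neg_zero]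
  -- on `(Π G_i) ∩ X⁻`, `x_{j₀} ∈ F_{j₀}` forces `x ∈ Π F_i`
  have hK : (F j₀).comap (Pi.evalAddMonoidHom X j₀) ⊓
      (AddSubgroup.pi Set.univ G ⊓ (τX + AddMonoidHom.id _).ker) =
      AddSubgroup.pi Set.univ F ⊓ (AddSubgroup.pi Set.univ G ⊓ (τX + AddMonoidHom.id _).ker) := by
    apply le_antisymm
    · rintro x ⟨hx0, hx⟩
      obtain ⟨hxG, hxm⟩ := AddSubgroup.mem_inf.mp hx
      have hx0' : x j₀ ∈ F j₀ := hx0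
      refine AddSubgroup.mem_inf.mpr ⟨mem_pi_of_forall F fun i => ?_, hx⟩
      by_cases h1 : i = j₀
      · subst h1; exact hx0'
      by_cases h2 : i = π j₀
      · subst h2
        rw [apply_eq_neg_of_mem_ker_add_id π eX τX hτX hxm (π j₀),
          apply_apply_congr eX x (π j₀) hππ]
        exact neg_mem (sF _ hx0')
      · rw [hoff i h1 h2]
        exact (AddSubgroup.mem_pi _).mp hxG i (Set.mem_univ _)
    · rintro x ⟨hxF, hx⟩
      exact ⟨(AddSubgroup.mem_pi _).mp hxF j₀ (Set.mem_univ _), hx⟩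
  rw [relIndex_pi_eq_relIndex_map_eval F j₀ _ hK, himg]

/-- **The local index at a FIXED place** (`π j₀ = j₀`; an inert Kolyvagin prime `λ = λ̄`): if
`F_i = G_i` away from `j₀`, then
`(Π F_i).relIndex ((Π G_i) ∩ X⁻) = (F_{j₀}).relIndex (G_{j₀} ∩ X_{j₀}⁻)`, where `X_{j₀}⁻` is the
`−`-part of the local involution `y ↦ (τ_X (single_{j₀} y))_{j₀}` (`= eX j₀ j₀ y`, written without
casts as `ev_{j₀} ∘ τ_X ∘ single_{j₀}`). In Jetchev's proof of Thm. 6.3 this is the `−ε`-part of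
`H¹(K_λ, E[p^m])/H¹_tr` (Lemma 5.2 (iii) at `λ`).
[cite: Jetchev2008, Lemma 5.2 (iii) (p. 822), proof of Thm. 6.3 (p. 823)] -/
theorem relIndex_pi_inf_ker_add_id_eq_of_fixed (hπ : Involutive π) (j₀ : ι) (hj : π j₀ = j₀)
    (hoff : ∀ i, i ≠ j₀ → F i = G i) :
    (AddSubgroup.pi Set.univ F).relIndex
        (AddSubgroup.pi Set.univ G ⊓ (τX + AddMonoidHom.id _).ker) =
      (F j₀).relIndex (G j₀ ⊓ ((Pi.evalAddMonoidHom X j₀).comp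
        (τX.comp (AddMonoidHom.single X j₀)) + AddMonoidHom.id _).ker) := by
  -- the local involution on `X j₀`, cast-free
  have hloc : ∀ y : X j₀, ((Pi.evalAddMonoidHom X j₀).comp (τX.comp (AddMonoidHom.single X j₀))) y =
      eX (π j₀) j₀ (Pi.single j₀ y (π j₀)) := fun y => by
    rw [AddMonoidHom.comp_apply, AddMonoidHom.comp_apply, Pi.evalAddMonoidHom_apply,
      AddMonoidHom.single_apply, hτX]
  -- for any tuple `x`, the `j₀`-coordinate of `τ_X x` only sees `x j₀` (as `π j₀ = j₀`)
  have hcoord : ∀ x : ∀ i, X i, τX x j₀ = eX (π j₀) j₀ (Pi.single j₀ (x j₀) (π j₀)) := by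
    intro x
    rw [hτX, apply_apply_congr eX x j₀ hj, apply_apply_congr eX (Pi.single j₀ (x j₀)) j₀ hj,
      Pi.single_eq_same]
  -- the image of the projection is `G j₀ ∩ X_{j₀}⁻`
  have himg : (AddSubgroup.pi Set.univ G ⊓ (τX + AddMonoidHom.id _).ker).map
      (Pi.evalAddMonoidHom X j₀) =
      G j₀ ⊓ ((Pi.evalAddMonoidHom X j₀).comp (τX.comp (AddMonoidHom.single X j₀)) +
        AddMonoidHom.id _).ker := by
    apply le_antisymm
    · rintro _ ⟨x, hx, rfl⟩
      obtain ⟨hxG, hxm⟩ := AddSubgroup.mem_inf.mp hx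
      refine AddSubgroup.mem_inf.mpr ⟨(AddSubgroup.mem_pi _).mp hxG j₀ (Set.mem_univ _), ?_⟩
      rw [mem_ker_add_id_iff, hloc]
      change eX (π j₀) j₀ (Pi.single j₀ (x j₀) (π j₀)) = -x j₀
      rw [← hcoord]
      have := congrFun ((mem_ker_add_id_iff τX x).mp hxm) j₀
      rw [this, Pi.neg_apply]
    · intro g hg'
      obtain ⟨hg, hgm⟩ := AddSubgroup.mem_inf.mp hg'
      rw [mem_ker_add_id_iff, hloc] at hgm
      refine ⟨Pi.single j₀ g, AddSubgroup.mem_inf.mpr ⟨mem_pi_of_forall G fun i => ?_, ?_⟩,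
        Pi.single_eq_same j₀ g⟩
      · by_cases h1 : i = j₀
        · subst h1; rw [Pi.single_eq_same]; exact hg
        · rw [Pi.single_eq_of_ne h1]; exact zero_mem _
      · rw [mem_ker_add_id_iff]
        funext i
        rw [Pi.neg_apply]
        by_cases h1 : i = j₀
        · subst h1
          rw [hcoord, Pi.single_eq_same, hgm]
        · have h3 : π i ≠ j₀ := fun h => h1 (by rw [← hπ i, h, hj])
          rw [hτX, Pi.single_eq_of_ne h1, Pi.single_eq_of_ne h3, map_zero, neg_zero]
  have hK : (F j₀).comap (Pi.evalAddMonoidHom X j₀) ⊓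
      (AddSubgroup.pi Set.univ G ⊓ (τX + AddMonoidHom.id _).ker) =
      AddSubgroup.pi Set.univ F ⊓ (AddSubgroup.pi Set.univ G ⊓ (τX + AddMonoidHom.id _).ker) := by
    apply le_antisymm
    · rintro x ⟨hx0, hx⟩
      obtain ⟨hxG, _⟩ := AddSubgroup.mem_inf.mp hx
      have hx0' : x j₀ ∈ F j₀ := hx0
      refine AddSubgroup.mem_inf.mpr ⟨mem_pi_of_forall F fun i => ?_, hx⟩
      by_cases h1 : i = j₀
      · subst h1; exact hx0'
      · rw [hoff i h1]
        exact (AddSubgroup.mem_pi _).mp hxG i (Set.mem_univ _)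
    · rintro x ⟨hxF, hx⟩
      exact ⟨(AddSubgroup.mem_pi _).mp hxF j₀ (Set.mem_univ _), hx⟩
  rw [relIndex_pi_eq_relIndex_map_eval F j₀ _ hK, himg]

end LocalIndex

end Summit.BirchSwinnertonDyer.Rank1Residual.JET.GlobalDuality

end
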